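import Mathlib

/-!
# `QuadraticDigitPhases` (stmt-QuantumAdvantage-1391), line `Sketch` — stub `stub_sparseImageCount`

Pure linear algebra over `𝔽₂ = ZMod 2`. For a matrix `B : 𝔽₂^{c × d}` of rank `r`, a threshold
`w` and a finite set `S ⊆ 𝔽₂^d`, the number of pairs `(x, x') ∈ S × S` whose mask `B (x - x')` has
fewer than `w` non-zero coordinates is at most `#S · (w r + 1)^w · 2^(d - r)`.

Proof.
* Fibres (`card_fibre_le`): every fibre of `x ↦ B x` is empty or a translate of `ker B`, and
  `#ker B = 2^(d - r)` by rank–nullity (`card_ker_eq`).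
* Sparse image vectors (`card_sparse_image_le`): the vectors `B x` with `< w` non-zero coordinates
  span a subspace of `range B`, hence one of dimension `≤ r`; a basis extracted from them consists
  of `≤ r` vectors each supported on `< w` coordinates, so all of them are supported inside a set
  `U` of `≤ w r` coordinates. Over `𝔽₂` a vector is determined by its support, so they inject into
  the subsets of `U` of size `< w`, of which there are `Σ_{k<w} C(#U, k) ≤ (#U + 1)^w ≤ (w r + 1)^w`
  (`card_powerset_filter_card_lt_le`, `sum_choose_le_pow`).
* Assembly: for fixed `x`, `y ↦ B (x - y)` maps the bad `y ∈ S` into the sparse image vectors with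
  fibres of size `≤ 2^(d - r)` (`card_slice_le`); summing over `x ∈ S` gives the claim.
-/

set_option linter.dupNamespace false -- D-0017: single-problem summit ⇒ `QuantumAdvantage.QuantumAdvantage` by design

namespace Summit.QuantumAdvantage.QuantumAdvantage.Theorems.MobiusLadderQuadraticDigitPhasesStubSparseImageCount

open Finset

/-- Partial sums of a row of Pascal's triangle: `Σ_{k ≤ w} C(n, k) ≤ (n + 1)^w`. [folklore] -/
theorem sum_choose_le_pow (n : ℕ) : ∀ w : ℕ, ∑ k ∈ range (w + 1), n.choose k ≤ (n + 1) ^ w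
  | 0 => by simp
  | w + 1 => by
    have h1 := sum_choose_le_pow n w
    have h2 : n.choose (w + 1) ≤ n ^ w * n := by
      have := Nat.choose_le_pow n (w + 1)
      rwa [pow_succ] at this
    have h3 : n ^ w ≤ (n + 1) ^ w := Nat.pow_le_pow_left (Nat.le_succ n) w
    rw [Finset.sum_range_succ]
    calc ∑ k ∈ range (w + 1), n.choose k + n.choose (w + 1)
        ≤ (n + 1) ^ w + n ^ w * n := Nat.add_le_add h1 h2
      _ ≤ (n + 1) ^ w + (n + 1) ^ w * n := Nat.add_le_add_left (Nat.mul_le_mul_right n h3) _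
      _ = (n + 1) ^ (w + 1) := by ring

/-- A finite set `U` has at most `(#U + 1)^w` subsets with fewer than `w` elements. [folklore] -/
theorem card_powerset_filter_card_lt_le {α : Type*} [DecidableEq α] (U : Finset α) (w : ℕ) :
    (U.powerset.filter fun T => T.card < w).card ≤ (U.card + 1) ^ w := by
  calc (U.powerset.filter fun T => T.card < w).card
      ≤ ((range w).biUnion fun k => U.powersetCard k).card := by
        refine card_le_card (fun T hT => ?_)
        rw [mem_filter, mem_powerset] at hT
        exact mem_biUnion.mpr ⟨T.card, mem_range.mpr hT.2, mem_powersetCard.mpr ⟨hT.1, rfl⟩⟩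
    _ ≤ ∑ k ∈ range w, (U.powersetCard k).card := card_biUnion_le
    _ = ∑ k ∈ range w, U.card.choose k := by simp_rw [card_powersetCard]
    _ ≤ ∑ k ∈ range (w + 1), U.card.choose k :=
        sum_le_sum_of_subset (range_subset_range.mpr (Nat.le_succ w))
    _ ≤ (U.card + 1) ^ w := sum_choose_le_pow U.card w

/-- Over `𝔽₂` the kernel of `z ↦ B z` has exactly `2^(d - rank B)` elements (rank–nullity and
`#V = 2^(dim V)`). [folklore] -/
theorem card_ker_eq {c d : ℕ} (B : Matrix (Fin c) (Fin d) (ZMod 2)) :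
    (univ.filter fun z : Fin d → ZMod 2 => B.mulVec z = 0).card = 2 ^ (d - B.rank) := by
  classical
  have hker : Module.finrank (ZMod 2) (LinearMap.ker B.mulVecLin) = d - B.rank := by
    have hrn := LinearMap.finrank_range_add_finrank_ker B.mulVecLin
    rw [Module.finrank_fin_fun] at hrn
    change B.rank + _ = d at hrn
    omega
  have h1 : Fintype.card (LinearMap.ker B.mulVecLin) =
      (univ.filter fun z : Fin d → ZMod 2 => B.mulVec z = 0).card :=
    Fintype.card_of_subtype _ (fun z => by simp)
  rw [← h1, Module.card_eq_pow_finrank (K := ZMod 2), ZMod.card]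
  exact congrArg (2 ^ ·) hker

/-- Every fibre of `z ↦ B z` over `𝔽₂` has at most `2^(d - rank B)` elements: it is empty or a
translate of the kernel. [folklore] -/
theorem card_fibre_le {c d : ℕ} (B : Matrix (Fin c) (Fin d) (ZMod 2)) (e : Fin c → ZMod 2) :
    (univ.filter fun z : Fin d → ZMod 2 => B.mulVec z = e).card ≤ 2 ^ (d - B.rank) := by
  rcases (univ.filter fun z : Fin d → ZMod 2 => B.mulVec z = e).eq_empty_or_nonempty with h | ⟨z₀, hz₀⟩
  · simp [h]
  · rw [mem_filter] at hz₀
    rw [← card_ker_eq B]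
    refine card_le_card_of_injOn (fun z => z - z₀) (fun z hz => ?_) (fun a _ b _ h => ?_)
    · have hz' : z ∈ univ.filter fun z : Fin d → ZMod 2 => B.mulVec z = e := hz
      rw [mem_filter] at hz'
      rw [mem_coe, mem_filter]
      exact ⟨mem_univ _, by rw [Matrix.mulVec_sub, hz'.2, hz₀.2, sub_self]⟩
    · simpa using h

/-- Over `𝔽₂` a vector is determined by its support `{i | v i ≠ 0}`. [folklore] -/
theorem eq_of_support_eq {c : ℕ} {u v : Fin c → ZMod 2}
    (h : (univ.filter fun i => u i ≠ 0) = (univ.filter fun i => v i ≠ 0)) : u = v := by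
  funext i
  have hi : (u i ≠ 0 ↔ v i ≠ 0) := by
    have := Finset.ext_iff.mp h i
    simpa using this
  generalize u i = a at hi
  generalize v i = b at hi
  revert a b
  decide

/-- A vector in the span of vectors vanishing outside `U` vanishes outside `U`. [folklore] -/
theorem apply_eq_zero_of_mem_span {c : ℕ} {s : Set (Fin c → ZMod 2)} {U : Finset (Fin c)}
    (hs : ∀ u ∈ s, ∀ i, i ∉ U → u i = 0) {v : Fin c → ZMod 2}
    (hv : v ∈ Submodule.span (ZMod 2) s) : ∀ i, i ∉ U → v i = 0 := by
  induction hv using Submodule.span_induction with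
  | mem u hu => exact hs u hu
  | zero => intro i _; rfl
  | add x y _ _ hx hy => intro i hi; rw [Pi.add_apply, hx i hi, hy i hi, add_zero]
  | smul a x _ hx => intro i hi; rw [Pi.smul_apply, hx i hi, smul_zero]

/-- The image vectors `B x` over `𝔽₂` with fewer than `w` non-zero coordinates number at most
`(w · rank B + 1)^w`: they live in a subspace of `range B` spanned by `≤ rank B` of them, hence are
all supported in a fixed set of `≤ w · rank B` coordinates, and a vector over `𝔽₂` is its support.
[folklore] -/
theorem card_sparse_image_le {c d : ℕ} (B : Matrix (Fin c) (Fin d) (ZMod 2)) (w : ℕ) :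
    ((univ.image B.mulVec).filter
        fun v => (univ.filter fun i : Fin c => v i ≠ 0).card < w).card ≤ (w * B.rank + 1) ^ w := by
  classical
  set X := (univ.image B.mulVec).filter
    fun v => (univ.filter fun i : Fin c => v i ≠ 0).card < w with hX
  -- `X ⊆ range B`
  have hXrange : (↑X : Set (Fin c → ZMod 2)) ⊆ LinearMap.range B.mulVecLin := by
    intro v hv
    rw [mem_coe, hX, mem_filter, mem_image] at hv
    obtain ⟨⟨x, -, rfl⟩, -⟩ := hv
    exact LinearMap.mem_range.mpr ⟨x, rfl⟩
  -- a linearly independent spanning subset `b ⊆ X`, as a finset `bf`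
  obtain ⟨b, hbX, hspan, hli⟩ := exists_linearIndependent (ZMod 2) (↑X : Set (Fin c → ZMod 2))
  set bf := (Set.toFinite b).toFinset with hbf_def
  have hbf : (↑bf : Set (Fin c → ZMod 2)) = b := Set.Finite.coe_toFinset _
  have hbfX : ∀ u ∈ bf, u ∈ X := fun u hu => hbX ((Set.Finite.mem_toFinset _).mp hu)
  have hspan' : Submodule.span (ZMod 2) (↑bf : Set (Fin c → ZMod 2)) =
      Submodule.span (ZMod 2) (↑X : Set (Fin c → ZMod 2)) := by rw [hbf, hspan]
  -- `#bf ≤ rank B`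
  have hcard : bf.card ≤ B.rank := by
    have hli' : LinearIndepOn (ZMod 2) id (↑bf : Set (Fin c → ZMod 2)) := by
      rw [hbf]; exact hli
    calc bf.card = Module.finrank (ZMod 2) (Submodule.span (ZMod 2) (↑bf : Set (Fin c → ZMod 2))) :=
          (finrank_span_finset_eq_card hli').symm
      _ ≤ Module.finrank (ZMod 2) (LinearMap.range B.mulVecLin) :=
          Submodule.finrank_mono (by rw [hspan']; exact Submodule.span_le.mpr hXrange)
      _ = B.rank := rfl
  -- the union `U` of the supports of the basis vectors has `≤ rank B * w` elements
  set U := bf.biUnion fun u => univ.filter fun i : Fin c => u i ≠ 0 with hU_def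
  have hU : U.card ≤ B.rank * w := by
    calc U.card ≤ ∑ u ∈ bf, (univ.filter fun i : Fin c => u i ≠ 0).card := card_biUnion_le
      _ ≤ ∑ _u ∈ bf, w := by
          refine sum_le_sum (fun u hu => le_of_lt ?_)
          have := hbfX u hu
          rw [hX, mem_filter] at this
          exact this.2
      _ = bf.card * w := by rw [sum_const, smul_eq_mul]
      _ ≤ B.rank * w := Nat.mul_le_mul_right w hcard
  -- every `v ∈ X` vanishes outside `U`
  have hzero : ∀ v ∈ X, ∀ i, i ∉ U → v i = 0 := by
    intro v hv
    have hvspan : v ∈ Submodule.span (ZMod 2) (↑bf : Set (Fin c → ZMod 2)) := by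
      rw [hspan']
      exact Submodule.subset_span (mem_coe.mpr hv)
    refine apply_eq_zero_of_mem_span (fun u hu i hi => ?_) hvspan
    by_contra hne
    exact hi (mem_biUnion.mpr ⟨u, mem_coe.mp hu, mem_filter.mpr ⟨mem_univ _, hne⟩⟩)
  -- inject `X` into the small subsets of `U` via the support map
  have hinj : X.card ≤ (U.powerset.filter fun T => T.card < w).card := by
    refine card_le_card_of_injOn (fun v => univ.filter fun i : Fin c => v i ≠ 0)
      (fun v hv => ?_) (fun v _ v' _ h => eq_of_support_eq h)
    have hv' : v ∈ X := hv
    rw [mem_coe, mem_filter, mem_powerset]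
    refine ⟨fun i hi => ?_, ?_⟩
    · by_contra hiU
      exact (mem_filter.mp hi).2 (hzero v hv' i hiU)
    · rw [hX, mem_filter] at hv'
      exact hv'.2
  calc X.card ≤ (U.powerset.filter fun T => T.card < w).card := hinj
    _ ≤ (U.card + 1) ^ w := card_powerset_filter_card_lt_le U w
    _ ≤ (w * B.rank + 1) ^ w := by
        apply Nat.pow_le_pow_left
        rw [Nat.mul_comm w]
        exact Nat.succ_le_succ hU

/-- For fixed `x`, the `y ∈ S` for which `B (x - y)` has fewer than `w` non-zero coordinates number
at most `(w · rank B + 1)^w · 2^(d - rank B)`. [folklore] -/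
theorem card_slice_le {c d : ℕ} (B : Matrix (Fin c) (Fin d) (ZMod 2)) (w : ℕ)
    (S : Finset (Fin d → ZMod 2)) (x : Fin d → ZMod 2) :
    (S.filter fun y => (univ.filter fun i : Fin c => (B.mulVec (x - y)) i ≠ 0).card < w).card ≤
      (w * B.rank + 1) ^ w * 2 ^ (d - B.rank) := by
  set T := S.filter fun y => (univ.filter fun i : Fin c => (B.mulVec (x - y)) i ≠ 0).card < w
    with hT
  set X := (univ.image B.mulVec).filter
    fun v => (univ.filter fun i : Fin c => v i ≠ 0).card < w with hX
  have hmaps : ∀ y ∈ T, B.mulVec (x - y) ∈ X := by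
    intro y hy
    rw [hT, mem_filter] at hy
    rw [hX, mem_filter]
    exact ⟨mem_image_of_mem _ (mem_univ _), hy.2⟩
  have hfib : ∀ e ∈ X, (T.filter fun y => B.mulVec (x - y) = e).card ≤ 2 ^ (d - B.rank) := by
    intro e _
    calc (T.filter fun y => B.mulVec (x - y) = e).card
        ≤ (univ.filter fun z : Fin d → ZMod 2 => B.mulVec z = B.mulVec x - e).card := by
          refine card_le_card (fun y hy => ?_)
          rw [mem_filter] at hy ⊢
          refine ⟨mem_univ _, ?_⟩
          rw [← hy.2, Matrix.mulVec_sub, sub_sub_cancel]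
      _ ≤ 2 ^ (d - B.rank) := card_fibre_le B _
  calc T.card ≤ 2 ^ (d - B.rank) * X.card :=
        card_le_mul_card_image_of_maps_to (f := fun y => B.mulVec (x - y)) hmaps _ hfib
    _ ≤ 2 ^ (d - B.rank) * (w * B.rank + 1) ^ w :=
        Nat.mul_le_mul_left _ (card_sparse_image_le B w)
    _ = (w * B.rank + 1) ^ w * 2 ^ (d - B.rank) := Nat.mul_comm _ _

/-- **Sparse image count.** For `B : 𝔽₂^{c × d}` of rank `r`, a threshold `w` and `S ⊆ 𝔽₂^d`, the
pairs `(x, x') ∈ S × S` whose mask `B (x - x')` has fewer than `w` non-zero coordinates number at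
most `#S · (w r + 1)^w · 2^(d - r)`: for each `x`, the mask ranges over the `≤ (w r + 1)^w` sparse
vectors of `range B` (`card_sparse_image_le`) with fibres of size `≤ #ker B = 2^(d - r)`
(`card_fibre_le`). [folklore] -/
theorem stub_sparseImageCount :
    ∀ (c d : ℕ) (B : Matrix (Fin c) (Fin d) (ZMod 2)) (w : ℕ) (S : Finset (Fin d → ZMod 2)),
        (((S ×ˢ S).filter (fun xy =>
            ((Finset.univ.filter fun i : Fin c => (B.mulVec (xy.1 - xy.2)) i ≠ 0).card < w))).card : ℝ) ≤
          S.card * ((w * B.rank + 1 : ℕ) : ℝ) ^ w * (2 : ℝ) ^ (d - B.rank) := by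
  intro c d B w S
  have key : ((S ×ˢ S).filter (fun xy =>
      ((Finset.univ.filter fun i : Fin c => (B.mulVec (xy.1 - xy.2)) i ≠ 0).card < w))).card ≤
      S.card * (w * B.rank + 1) ^ w * 2 ^ (d - B.rank) := by
    rw [card_filter, sum_product]
    calc ∑ x ∈ S, ∑ y ∈ S,
          (if (univ.filter fun i : Fin c => (B.mulVec ((x, y).1 - (x, y).2)) i ≠ 0).card < w
            then 1 else 0)
        = ∑ x ∈ S, (S.filter fun y =>
            (univ.filter fun i : Fin c => (B.mulVec (x - y)) i ≠ 0).card < w).card := by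
          refine sum_congr rfl (fun x _ => ?_)
          rw [card_filter]
      _ ≤ ∑ _x ∈ S, (w * B.rank + 1) ^ w * 2 ^ (d - B.rank) :=
          sum_le_sum (fun x _ => card_slice_le B w S x)
      _ = S.card * (w * B.rank + 1) ^ w * 2 ^ (d - B.rank) := by
          rw [sum_const, smul_eq_mul, Nat.mul_assoc]
  exact_mod_cast key

end Summit.QuantumAdvantage.QuantumAdvantage.Theorems.MobiusLadderQuadraticDigitPhasesStubSparseImageCount
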